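import Summits.ValiantsHypothesis.ValiantsHypothesis.Theorems.FeketeSOSFeketeSOSHardPaleyRIPHankelFourier
import Summits.ValiantsHypothesis.ValiantsHypothesis.Theorems.FeketeSOSFeketeSOSHardPaleyRIPCompletion

/-!
# Route FeketeSOS — crux `FeketeSOSHard` (stmt-ValiantsHypothesis-3996), line `paley-rip` (v3),
# stub `stub_paleyFlatRIP`: the fourth-moment bound `|Q_p(S,w)|⁴ ≤ tr(H_S⁴)·‖w‖⁸` and the cycle sum

First of three files proving that the engine inequality `|Q_p(S,w)| ≤ p^{1/2−κ} Σ_{a∈S}|w_a|²` holds for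
ALMOST ALL supports of each size (`…PaleyRIPRandomSupport.lean`).  Here the deterministic half:

* `norm_paleyForm_pow_four_le` — `|Q_p(S,w)|⁴ ≤ tr(H_S⁴) · (Σ_{a∈S}|w_a|²)⁴` for every complex `w`, where
  `H_S = (χ_p(a+b))_{a,b∈S}` and `tr(H_S⁴) = Σ_{b,d∈S} |Σ_{a∈S} χ_p(a+b)χ_p(a+d)|²` — Cauchy–Schwarz twice
  (`|wᵀHw| ≤ ‖w‖‖Hw‖`, `‖Hw‖² = ⟨H²w,w⟩ ≤ ‖w‖‖H²w‖ ≤ ‖w‖²‖H²‖_F`), no spectral theorem;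
  `norm_paleyForm_le_of_trace_four_le` — so `tr(H_S⁴) ≤ L⁴` gives the engine inequality with constant `L`;
* `trace_four_eq_re_cycleSum` — `tr(H_S⁴) = Σ_{a,b,c,d∈S} χ_p(a+b)χ_p(b+c)χ_p(c+d)χ_p(d+a)` (real part);
* `norm_cycleSum_range_le` — the COMPLETE cycle sum over `[0,p)⁴` is `Σ_{b,d} J(b,d)²` with the
  Jacobsthal sums `J(b,b) = p − 1`, `J(b,d) ∈ {0,−1}` (`b ≠ d`; `jac_nat` of `…PaleyRIPCompletion`), hence
  has modulus `≤ 2p³` — square-root cancellation (trivially `p⁴`), the arithmetic input of the whole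
  argument.

Honest framing (rung currency): Theorems-side helper `--supports` stmt-3996; the engine (all supports),
`stub_tameOperator` and the crux stay OPEN; `VP ≠ VNP` is untouched.
-/

set_option linter.dupNamespace false

namespace Summit.ValiantsHypothesis.ValiantsHypothesis.Theorems.FeketeSOSHardPaleyRIP

open Finset Complex
open scoped BigOperators ComplexConjugate

noncomputable section

/-! ## Cauchy–Schwarz twice: `|Q|⁴ ≤ tr(H⁴)·‖w‖⁸` -/

section Deterministic

variable (p : ℕ) [Fact p.Prime]

omit [Fact p.Prime] in
/-- Cauchy–Schwarz for a bilinear pairing of complex vectors: `|Σ_a u_a v_a|² ≤ (Σ_a |u_a|²)(Σ_a |v_a|²)`.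
[folklore] -/
theorem norm_sum_mul_sq_le (S : Finset ℕ) (u v : ℕ → ℂ) :
    ‖∑ a ∈ S, u a * v a‖ ^ 2 ≤ (∑ a ∈ S, ‖u a‖ ^ 2) * ∑ a ∈ S, ‖v a‖ ^ 2 := by
  have h1 : ‖∑ a ∈ S, u a * v a‖ ≤ ∑ a ∈ S, ‖u a‖ * ‖v a‖ :=
    (norm_sum_le _ _).trans (Finset.sum_le_sum fun a _ => (norm_mul_le _ _))
  have h2 := Finset.sum_mul_sq_le_sq_mul_sq S (fun a => ‖u a‖) (fun a => ‖v a‖)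
  calc ‖∑ a ∈ S, u a * v a‖ ^ 2 ≤ (∑ a ∈ S, ‖u a‖ * ‖v a‖) ^ 2 :=
        pow_le_pow_left₀ (norm_nonneg _) h1 2
    _ ≤ _ := h2

/-- The kernel `χ_p(a+b)` has modulus `≤ 1`. [folklore] -/
theorem norm_chi_le_one (x : ZMod p) : ‖((quadraticChar (ZMod p) x : ℤ) : ℂ)‖ ≤ 1 := by
  rcases quadraticChar_isQuadratic (ZMod p) x with h | h | h <;> simp [h]

/-- **Fourth-moment bound for the Paley–Hankel form.**  For every `S` and every complex weight `w`,
`|Q_p(S,w)|⁴ ≤ tr(H_S⁴) · (Σ_{a∈S}|w_a|²)⁴`, where `tr(H_S⁴) = Σ_{b,d∈S} |Σ_{a∈S} χ_p(a+b) χ_p(a+d)|²` is the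
trace of the fourth power of the real symmetric matrix `H_S = (χ_p(a+b))_{a,b∈S}`.  Two applications of
Cauchy–Schwarz (`|wᵀHw| ≤ ‖w‖‖Hw‖`, `‖Hw‖² = ⟨H²w,w⟩ ≤ ‖w‖‖H²w‖ ≤ ‖w‖²‖H²‖_F`). [folklore] -/
theorem norm_paleyForm_pow_four_le (S : Finset ℕ) (w : ℕ → ℂ) :
    ‖paleyForm p S w‖ ^ 4 ≤
      (∑ b ∈ S, ∑ d ∈ S, ‖∑ a ∈ S, ((quadraticChar (ZMod p) ((a : ZMod p) + (b : ZMod p)) : ℤ) : ℂ) *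
          ((quadraticChar (ZMod p) ((a : ZMod p) + (d : ZMod p)) : ℤ) : ℂ)‖ ^ 2) *
        (∑ a ∈ S, ‖w a‖ ^ 2) ^ 4 := by
  set K : ℕ → ℕ → ℂ := fun a b => ((quadraticChar (ZMod p) ((a : ZMod p) + (b : ZMod p)) : ℤ) : ℂ)
    with hK
  set W : ℝ := ∑ a ∈ S, ‖w a‖ ^ 2 with hW
  have hW0 : 0 ≤ W := Finset.sum_nonneg fun a _ => sq_nonneg _
  -- `u = Hw`, `G = H²`
  set u : ℕ → ℂ := fun a => ∑ b ∈ S, K a b * w b with hu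
  set G : ℕ → ℕ → ℂ := fun b d => ∑ a ∈ S, K a b * K a d with hG
  set X : ℝ := ∑ a ∈ S, ‖u a‖ ^ 2 with hX
  have hX0 : 0 ≤ X := Finset.sum_nonneg fun a _ => sq_nonneg _
  set Y : ℝ := ∑ b ∈ S, ‖∑ d ∈ S, G b d * conj (w d)‖ ^ 2 with hY
  set T : ℝ := ∑ b ∈ S, ∑ d ∈ S, ‖G b d‖ ^ 2 with hT
  -- Step 1: `|Q|² ≤ W·X`
  have hQ : paleyForm p S w = ∑ a ∈ S, w a * u a := paleyForm_eq_sum_mul_uForm p S w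
  have h1 : ‖paleyForm p S w‖ ^ 2 ≤ W * X := by
    rw [hQ]; exact norm_sum_mul_sq_le S w u
  -- Step 2: `X = Σ_b w_b (Σ_d G(b,d) conj w_d)` as complex numbers, so `X² ≤ W·Y`
  have hKreal : ∀ a b : ℕ, conj (K a b) = K a b := fun a b => conj_chiZ p _
  have hXc : ((X : ℝ) : ℂ) = ∑ b ∈ S, w b * ∑ d ∈ S, G b d * conj (w d) := by
    rw [hX]
    push_cast
    have hterm : ∀ a ∈ S, ((‖u a‖ : ℂ)) ^ 2 =
        ∑ b ∈ S, ∑ d ∈ S, w b * (K a b * K a d * conj (w d)) := by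
      intro a _
      rw [← Complex.mul_conj', hu]
      simp only [map_sum, map_mul, hKreal]
      rw [Finset.sum_mul_sum]
      refine Finset.sum_congr rfl fun b _ => Finset.sum_congr rfl fun d _ => ?_
      ring
    rw [Finset.sum_congr rfl hterm, Finset.sum_comm]
    refine Finset.sum_congr rfl fun b _ => ?_
    rw [Finset.sum_comm, Finset.mul_sum]
    refine Finset.sum_congr rfl fun d _ => ?_
    simp only [hG, Finset.sum_mul, Finset.mul_sum]
  have h2 : X ^ 2 ≤ W * Y := by
    have h := norm_sum_mul_sq_le S w (fun b => ∑ d ∈ S, G b d * conj (w d))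
    rw [← hXc, Complex.norm_real, Real.norm_of_nonneg hX0] at h
    exact h
  -- Step 3: `Y ≤ T·W`
  have h3 : Y ≤ T * W := by
    rw [hY, hT, Finset.sum_mul]
    refine Finset.sum_le_sum fun b _ => ?_
    have h := norm_sum_mul_sq_le S (fun d => G b d) (fun d => conj (w d))
    simp only [Complex.norm_conj] at h
    exact h
  -- combine: `|Q|⁴ ≤ (W X)² = W² X² ≤ W² (W Y) ≤ W³ T W`
  have hT0 : 0 ≤ T := Finset.sum_nonneg fun b _ => Finset.sum_nonneg fun d _ => sq_nonneg _
  calc ‖paleyForm p S w‖ ^ 4 = (‖paleyForm p S w‖ ^ 2) ^ 2 := by ring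
    _ ≤ (W * X) ^ 2 := pow_le_pow_left₀ (sq_nonneg _) h1 2
    _ = W ^ 2 * X ^ 2 := by ring
    _ ≤ W ^ 2 * (W * Y) := mul_le_mul_of_nonneg_left h2 (sq_nonneg _)
    _ ≤ W ^ 2 * (W * (T * W)) :=
        mul_le_mul_of_nonneg_left (mul_le_mul_of_nonneg_left h3 hW0) (sq_nonneg _)
    _ = T * W ^ 4 := by ring

/-- If `tr(H_S⁴) ≤ L⁴` (`L ≥ 0`), then `|Q_p(S,w)| ≤ L·Σ_{a∈S}|w_a|²` for every complex `w`. [folklore] -/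
theorem norm_paleyForm_le_of_trace_four_le (S : Finset ℕ) (L : ℝ) (hL : 0 ≤ L)
    (hT : (∑ b ∈ S, ∑ d ∈ S, ‖∑ a ∈ S, ((quadraticChar (ZMod p) ((a : ZMod p) + (b : ZMod p)) : ℤ) : ℂ) *
          ((quadraticChar (ZMod p) ((a : ZMod p) + (d : ZMod p)) : ℤ) : ℂ)‖ ^ 2) ≤ L ^ 4)
    (w : ℕ → ℂ) :
    ‖paleyForm p S w‖ ≤ L * ∑ a ∈ S, ‖w a‖ ^ 2 := by
  have hW0 : 0 ≤ ∑ a ∈ S, ‖w a‖ ^ 2 := Finset.sum_nonneg fun a _ => sq_nonneg _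
  have h := norm_paleyForm_pow_four_le p S w
  have h4 : ‖paleyForm p S w‖ ^ 4 ≤ (L * ∑ a ∈ S, ‖w a‖ ^ 2) ^ 4 := by
    calc ‖paleyForm p S w‖ ^ 4 ≤ _ := h
      _ ≤ L ^ 4 * (∑ a ∈ S, ‖w a‖ ^ 2) ^ 4 := mul_le_mul_of_nonneg_right hT (pow_nonneg hW0 4)
      _ = (L * ∑ a ∈ S, ‖w a‖ ^ 2) ^ 4 := by ring
  exact (pow_le_pow_iff_left₀ (norm_nonneg _) (mul_nonneg hL hW0) (by norm_num)).1 h4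

end Deterministic

/-! ## The cycle sum `Σ χ(a+b)χ(b+c)χ(c+d)χ(d+a)` and the trace of `H_S⁴` -/

section CycleSum

variable (p : ℕ) [Fact p.Prime]

/-- The kernel is symmetric: `χ_p(a+b) = χ_p(b+a)`. [folklore] -/
theorem chi_add_comm (a b : ℕ) :
    ((quadraticChar (ZMod p) ((a : ZMod p) + (b : ZMod p)) : ℤ) : ℂ) =
      ((quadraticChar (ZMod p) ((b : ZMod p) + (a : ZMod p)) : ℤ) : ℂ) := by
  rw [add_comm]

/-- A fourfold sum can be reordered from `(b, d, a, c)` to `(a, b, c, d)`. [folklore] -/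
theorem sum_quad_reorder {R : Type*} [AddCommMonoid R] (A : Finset ℕ) (T : ℕ → ℕ → ℕ → ℕ → R) :
    ∑ b ∈ A, ∑ d ∈ A, ∑ a ∈ A, ∑ c ∈ A, T a b c d = ∑ a ∈ A, ∑ b ∈ A, ∑ c ∈ A, ∑ d ∈ A, T a b c d := by
  calc ∑ b ∈ A, ∑ d ∈ A, ∑ a ∈ A, ∑ c ∈ A, T a b c d
      = ∑ b ∈ A, ∑ a ∈ A, ∑ d ∈ A, ∑ c ∈ A, T a b c d :=
        Finset.sum_congr rfl fun b _ => Finset.sum_comm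
    _ = ∑ a ∈ A, ∑ b ∈ A, ∑ d ∈ A, ∑ c ∈ A, T a b c d := Finset.sum_comm
    _ = ∑ a ∈ A, ∑ b ∈ A, ∑ c ∈ A, ∑ d ∈ A, T a b c d :=
        Finset.sum_congr rfl fun a _ => Finset.sum_congr rfl fun b _ => Finset.sum_comm

/-- **`tr(H_S⁴)` as a cycle sum**: `Σ_{b,d∈S} |Σ_{a∈S} χ(a+b)χ(a+d)|² = Re Σ_{a,b,c,d∈S} χ(a+b)χ(b+c)χ(c+d)χ(d+a)`
(the kernel is real and symmetric; the cycle sum is in fact real). [folklore] -/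
theorem trace_four_eq_re_cycleSum (S : Finset ℕ) :
    (∑ b ∈ S, ∑ d ∈ S, ‖∑ a ∈ S, ((quadraticChar (ZMod p) ((a : ZMod p) + (b : ZMod p)) : ℤ) : ℂ) *
        ((quadraticChar (ZMod p) ((a : ZMod p) + (d : ZMod p)) : ℤ) : ℂ)‖ ^ 2) =
      (∑ a ∈ S, ∑ b ∈ S, ∑ c ∈ S, ∑ d ∈ S,
        ((quadraticChar (ZMod p) ((a : ZMod p) + (b : ZMod p)) : ℤ) : ℂ) *
        ((quadraticChar (ZMod p) ((b : ZMod p) + (c : ZMod p)) : ℤ) : ℂ) *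
        ((quadraticChar (ZMod p) ((c : ZMod p) + (d : ZMod p)) : ℤ) : ℂ) *
        ((quadraticChar (ZMod p) ((d : ZMod p) + (a : ZMod p)) : ℤ) : ℂ)).re := by
  set K : ℕ → ℕ → ℂ := fun a b => ((quadraticChar (ZMod p) ((a : ZMod p) + (b : ZMod p)) : ℤ) : ℂ)
    with hK
  have hKreal : ∀ a b : ℕ, conj (K a b) = K a b := fun a b => conj_chiZ p _
  have hKsymm : ∀ a b : ℕ, K a b = K b a := fun a b => chi_add_comm p a b
  -- `|G(b,d)|² = Re Σ_a Σ_c K a b K a d K c b K c d`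
  have hsq : ∀ b d : ℕ, ‖∑ a ∈ S, K a b * K a d‖ ^ 2 =
      (∑ a ∈ S, ∑ c ∈ S, K a b * K b c * K c d * K d a).re := by
    intro b d
    have h1 : ((‖∑ a ∈ S, K a b * K a d‖ ^ 2 : ℝ) : ℂ) =
        ∑ a ∈ S, ∑ c ∈ S, K a b * K b c * K c d * K d a := by
      push_cast
      rw [← Complex.mul_conj', map_sum, Finset.sum_mul_sum]
      refine Finset.sum_congr rfl fun a _ => Finset.sum_congr rfl fun c _ => ?_
      rw [map_mul, hKreal, hKreal, hKsymm c b, hKsymm a d]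
      ring
    have h2 := congrArg Complex.re h1
    rw [Complex.ofReal_re] at h2
    exact h2
  show (∑ b ∈ S, ∑ d ∈ S, ‖∑ a ∈ S, K a b * K a d‖ ^ 2) =
    (∑ a ∈ S, ∑ b ∈ S, ∑ c ∈ S, ∑ d ∈ S, K a b * K b c * K c d * K d a).re
  simp_rw [hsq]
  have h3 : ∑ b ∈ S, ∑ d ∈ S, (∑ a ∈ S, ∑ c ∈ S, K a b * K b c * K c d * K d a).re =
      (∑ b ∈ S, ∑ d ∈ S, ∑ a ∈ S, ∑ c ∈ S, K a b * K b c * K c d * K d a).re := by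
    rw [Complex.re_sum]
    refine Finset.sum_congr rfl fun b _ => ?_
    rw [Complex.re_sum]
  rw [h3, sum_quad_reorder]

/-- **The complete cycle sum has square-root cancellation**: with `U = [0,p)`,
`|Σ_{a,b,c,d∈U} χ(a+b)χ(b+c)χ(c+d)χ(d+a)| ≤ 2p³` (trivially `p⁴`).  Indeed the sum is `Σ_{b,d} J(b,d)²`
with the Jacobsthal sums `J(b,b) = p − 1` and `J(b,d) ∈ {0,−1}` for `b ≠ d` (`jac_nat`). [folklore] -/
theorem norm_cycleSum_range_le :
    ‖∑ a ∈ range p, ∑ b ∈ range p, ∑ c ∈ range p, ∑ d ∈ range p,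
        ((quadraticChar (ZMod p) ((a : ZMod p) + (b : ZMod p)) : ℤ) : ℂ) *
        ((quadraticChar (ZMod p) ((b : ZMod p) + (c : ZMod p)) : ℤ) : ℂ) *
        ((quadraticChar (ZMod p) ((c : ZMod p) + (d : ZMod p)) : ℤ) : ℂ) *
        ((quadraticChar (ZMod p) ((d : ZMod p) + (a : ZMod p)) : ℤ) : ℂ)‖ ≤ 2 * (p : ℝ) ^ 3 := by
  set K : ℕ → ℕ → ℂ := fun a b => ((quadraticChar (ZMod p) ((a : ZMod p) + (b : ZMod p)) : ℤ) : ℂ)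
    with hK
  have hKsymm : ∀ a b : ℕ, K a b = K b a := fun a b => chi_add_comm p a b
  set J : ℕ → ℕ → ℂ := fun b d => ∑ a ∈ range p, K a b * K a d with hJ
  show ‖∑ a ∈ range p, ∑ b ∈ range p, ∑ c ∈ range p, ∑ d ∈ range p,
      K a b * K b c * K c d * K d a‖ ≤ 2 * (p : ℝ) ^ 3
  -- the cycle sum is `Σ_{b,d} J(b,d)²`
  have hcyc : ∑ a ∈ range p, ∑ b ∈ range p, ∑ c ∈ range p, ∑ d ∈ range p,
      K a b * K b c * K c d * K d a = ∑ b ∈ range p, ∑ d ∈ range p, J b d * J b d := by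
    rw [← sum_quad_reorder]
    refine Finset.sum_congr rfl fun b _ => Finset.sum_congr rfl fun d _ => ?_
    rw [hJ, Finset.sum_mul_sum]
    refine Finset.sum_congr rfl fun a _ => Finset.sum_congr rfl fun c _ => ?_
    rw [hKsymm b c, hKsymm d a]; ring
  -- the Jacobsthal table
  haveI : NeZero p := ⟨(Fact.out : p.Prime).ne_zero⟩
  have hJval : ∀ b ∈ range p, ∀ d ∈ range p,
      J b d = if b = d then (p : ℂ) - 1 else (if p = 2 then (0 : ℂ) else -1) := by
    intro b hb d hd
    rw [← jac_nat p (S := range p) (fun a ha => mem_range.1 ha) hb hd, sum_zmod_eq_sum_range]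
  have hJnorm : ∀ b ∈ range p, ∀ d ∈ range p,
      ‖J b d‖ ^ 2 ≤ (if b = d then (p : ℝ) ^ 2 else 0) + 1 := by
    intro b hb d hd
    rw [hJval b hb d hd]
    have hp1 : (1 : ℝ) ≤ (p : ℝ) := by exact_mod_cast (Fact.out : p.Prime).one_lt.le
    split_ifs with hbd hp2
    · have : ‖(p : ℂ) - 1‖ = (p : ℝ) - 1 := by
        rw [show (p : ℂ) - 1 = (((p : ℝ) - 1 : ℝ) : ℂ) by push_cast; ring, Complex.norm_real,
          Real.norm_of_nonneg (by linarith)]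
      rw [this]; nlinarith
    · simp
    · simp
  calc ‖∑ a ∈ range p, ∑ b ∈ range p, ∑ c ∈ range p, ∑ d ∈ range p, K a b * K b c * K c d * K d a‖
      = ‖∑ b ∈ range p, ∑ d ∈ range p, J b d * J b d‖ := by rw [hcyc]
    _ ≤ ∑ b ∈ range p, ∑ d ∈ range p, ‖J b d‖ ^ 2 := by
        refine (norm_sum_le _ _).trans (Finset.sum_le_sum fun b _ => ?_)
        refine (norm_sum_le _ _).trans (Finset.sum_le_sum fun d _ => ?_)
        rw [norm_mul, sq]
    _ ≤ ∑ b ∈ range p, ∑ d ∈ range p, ((if b = d then (p : ℝ) ^ 2 else 0) + 1) :=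
        Finset.sum_le_sum fun b hb => Finset.sum_le_sum fun d hd => hJnorm b hb d hd
    _ = ∑ b ∈ range p, ((p : ℝ) ^ 2 + p) := by
        refine Finset.sum_congr rfl fun b hb => ?_
        rw [Finset.sum_add_distrib, Finset.sum_ite_eq (range p) b, if_pos hb, Finset.sum_const,
          card_range]
        simp
    _ = (p : ℝ) ^ 3 + (p : ℝ) ^ 2 := by rw [Finset.sum_const, card_range]; simp; ring
    _ ≤ 2 * (p : ℝ) ^ 3 := by
        have hp1 : (1 : ℝ) ≤ (p : ℝ) := by exact_mod_cast (Fact.out : p.Prime).one_lt.le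
        nlinarith

end CycleSum

end

end Summit.ValiantsHypothesis.ValiantsHypothesis.Theorems.FeketeSOSHardPaleyRIP
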